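import Summits.ResolutionOfSingularities.ResolutionOfSingularities.Theorems.MarkedTransferCampaignW46MohWindowSurfaceTerminationTwo
import Summits.ResolutionOfSingularities.ResolutionOfSingularities.Theorems.MarkedTransferCampaignW46MohWindowSurfaceCentreFibre
import HarnessLib

/-!
# [OURS · L1 W4.6 rung (iii-2), HEAVY-ROOT SIDE, `p = 2`] Surface Moh window — THE EXIT BOUND: every permissible sequence inside
# the purely inseparable surface window at `p = 2` has LENGTH `≤ 2 · #Sing(E₀)`; the named rung
# `MohWindowSurfaceInsepFinLocalExitBound 2 K` (cell res-hironaka, LADDER-RESOLUTION rung L, D-0089; seat res-L1-s46-pv-5 gen 5;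
# host MarkedTransfer, `--supports stmt-ResolutionOfSingularities-16155 --as helper`; statement file `…CampaignW46MohWindowSurface.lean`)

HONEST FRAMING. Nothing here is a statement of H. Hironaka's manuscript [Hironaka2017] and nothing here asserts that any
statement of it holds. THEOREMS about the OURS regime `CampaignW46.Regime.mohWindowSurface` (o1 §5) at `p = 2`, closing BY NAME
the EXIT-BOUND FORM `MohWindowSurfaceInsepFinLocalExitBound 2 K` of res-L1-type-o1's statement file (§3; RUNG MAP (iii-2) «open:
the non-tame all-window forms `MohWindowSurface[Insep]{PermissiblyTerminates,FinLocalExitBound}`» — the `PermissiblyTerminates` half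
at `p = 2` is `…TerminationTwo.lean`). MECHANISM: the weight `0/1/2` (frozen / pure / other) of `…TerminationTwo.lean` summed over
`Sing(E)` is a POTENTIAL that drops by at least `1` at every admitted blow-up — the centre has weight `≥ 1`
(`…CentreChild.lean`: a frozen point is never a centre), it has AT MOST ONE singular child (`…CentreFibre.lean`, fibre
uniqueness) and that child has strictly smaller weight (`weight_lt_of_over_centre`), the other singular points are transported
with their weights. Hence `len ≤ Σ weights ≤ 2 · #Sing(E₀)`. o1's (VAC) remark «`β` must see fine germ data» concerns general `p`
(arbitrarily long in-window chains, res-L1-s46-pv-6); at `p = 2` the window is `{d = 3}` and the bound is a point count.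
AI-written; AI review is weaker than expert review. No `sorry`; axioms standard.

WHAT IS PROVED.
* `sum_val_succ_add_one_le` — abstract potential step: for a permissible point blow-up with finite singular loci, weights
  transported off the centre, dropping over it, centre weight `≥ 1` and AT MOST ONE singular point over the centre,
  `Σ_{Sing(E′)} val′ + 1 ≤ Σ_{Sing(E)} val`.
* `one_le_weight_of_mem_centre` — an admitted centre (transform in the regime) is not frozen.
* `FinPermissibleRun.len_le_two_mul_ncard_sing` — **every finite §2.1-permissible sequence inside `Regime.mohWindowSurface`
  (`p = 2`) has length `≤ 2 · #Sing(E₀)`**.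
* `finLocalExitBound_mohWindowSurface_two`, **`mohWindowSurfaceInsepFinLocalExitBound_two (K) : MohWindowSurfaceInsepFinLocalExitBound 2 K`**
  (`β(A, E, x) = 2 · #Sing(E)`), for EVERY field `K` of characteristic `2`. [ZariskiSamuel1960] [Matsumura1987] [HauserWagner2014]
-/

noncomputable section

set_option linter.dupNamespace false -- mandated namespace of this single-conjunct summit

open CategoryTheory AlgebraicGeometry TopologicalSpace IsLocalRing

namespace Summit.ResolutionOfSingularities.ResolutionOfSingularities.Theorems

namespace CampaignW46

open Literature.AlgebraicGeometry.Resolution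
open Literature.AlgebraicGeometry.Hironaka2017.S02Preliminaries
open Literature.AlgebraicGeometry.Hironaka2017.Datum
open Literature.AlgebraicGeometry.Hironaka2017.S16Proof
open Scheme.IdealSheafData

universe u

/-! ## 1. The abstract potential step -/

section Campaign

variable {K : Type u} [Field K] [CharP K 2]
variable {A A' : AmbientDatum 2 K} {E : IdealExponent A.Z}

/-- **Abstract potential step.** For a permissible blow-up with `Sing(E)` a finite set of closed points and `Sing(E′)` finite,
weights `val, val′` TRANSPORTED off the centre and DROPPING over it, the centre point of weight `≥ 1`, and AT MOST ONE singular point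
over the centre: `Σ_{Sing(E′)} val′ + 1 ≤ Σ_{Sing(E)} val`. [folklore] -/
theorem sum_val_succ_add_one_le {D : Closeds A.Z} (π : A'.Z ⟶ A.Z)
    (hπ : IsBlowup π (vanishingIdeal D)) (hD : E.IsPermissibleCentre A.hom D) (hfin : E.sing.Finite)
    (hcl : E.sing ⊆ Literature.AlgebraicGeometry.Hironaka2017.S02Preliminaries.closedPoints A.Z)
    (hfin' : (E.transform π D).sing.Finite) (val : A.Z → ℕ) (val' : A'.Z → ℕ)
    (hoff : ∀ x' ∈ (E.transform π D).sing, π.base x' ∉ (D : Set A.Z) → val' x' = val (π.base x'))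
    (hon : ∀ x' ∈ (E.transform π D).sing, π.base x' ∈ (D : Set A.Z) → val' x' < val (π.base x'))
    (hpos : ∀ ξ ∈ (D : Set A.Z), 1 ≤ val ξ)
    (huniq : ((E.transform π D).sing ∩ π.base ⁻¹' (D : Set A.Z)).Subsingleton) :
    (∑ x' ∈ hfin'.toFinset, val' x') + 1 ≤ ∑ x ∈ hfin.toFinset, val x := by
  classical
  obtain ⟨ξ, hξS, hξcl, hDξ⟩ := IsPermissibleCentre.exists_eq_singleton_of_isolatedSing hD ⟨hfin, hcl⟩
  set S : Finset A.Z := hfin.toFinset with hS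
  set S' : Finset A'.Z := hfin'.toFinset with hS'
  set Son : Finset A'.Z := S'.filter fun x' => π.base x' = ξ with hSon
  set Soff : Finset A'.Z := S'.filter fun x' => ¬ π.base x' = ξ with hSoff
  have hξmem : ξ ∈ S := by rw [hS, Set.Finite.mem_toFinset]; exact hξS
  have hmemS' : ∀ x', x' ∈ S' ↔ x' ∈ (E.transform π D).sing := fun x' => by rw [hS', Set.Finite.mem_toFinset]
  have hsplit : ∑ x' ∈ S', val' x' = ∑ x' ∈ Soff, val' x' + ∑ x' ∈ Son, val' x' := by
    rw [hSoff, hSon, ← Finset.sum_filter_add_sum_filter_not S' (fun x' => π.base x' = ξ) val', add_comm]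
  -- off the centre: transported weights, injectively, into `Sing(E) ∖ {ξ}`
  have hoffD : ∀ x' ∈ Soff, π.base x' ∉ (D : Set A.Z) := fun x' hx' => by
    rw [hSoff, Finset.mem_filter] at hx'
    rw [hDξ]; exact hx'.2
  have hinj : Set.InjOn π.base (Soff : Set A'.Z) :=
    (MohWindow.injOn_preimage_compl hπ).mono fun x' hx' => hoffD x' hx'
  have himage : Soff.image π.base ⊆ S.erase ξ := by
    intro η hη
    obtain ⟨x', hx', rfl⟩ := Finset.mem_image.mp hη
    have hx'S : x' ∈ (E.transform π D).sing := (hmemS' x').mp (Finset.mem_filter.mp hx').1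
    refine Finset.mem_erase.mpr ⟨?_, ?_⟩
    · have := hoffD x' hx'; rw [hDξ] at this; exact this
    · rw [hS, Set.Finite.mem_toFinset]
      exact MohWindowSurfacePermissible.base_mem_sing_of_not_over_centre π hπ hx'S (hoffD x' hx')
  have hXle : ∑ x' ∈ Soff, val' x' ≤ ∑ x ∈ S.erase ξ, val x :=
    calc ∑ x' ∈ Soff, val' x' = ∑ x' ∈ Soff, val (π.base x') :=
          Finset.sum_congr rfl fun x' hx' => hoff x' ((hmemS' x').mp (Finset.mem_filter.mp hx').1) (hoffD x' hx')
      _ = ∑ x ∈ Soff.image π.base, val x := (Finset.sum_image fun a ha b hb h => hinj ha hb h).symm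
      _ ≤ ∑ x ∈ S.erase ξ, val x := Finset.sum_le_sum_of_subset_of_nonneg himage fun _ _ _ => Nat.zero_le _
  have hSval : ∑ x ∈ S.erase ξ, val x + val ξ = ∑ x ∈ S, val x := Finset.sum_erase_add S val hξmem
  -- over the centre: at most one point, of weight `≤ val ξ - 1`
  have hon' : ∑ x' ∈ Son, val' x' + 1 ≤ val ξ := by
    rcases Son.eq_empty_or_nonempty with h | ⟨x₀, hx₀⟩
    · rw [h, Finset.sum_empty, zero_add]
      exact hpos ξ (by rw [hDξ]; exact Set.mem_singleton ξ)
    · have hmem : ∀ x' ∈ Son, x' ∈ (E.transform π D).sing ∩ π.base ⁻¹' (D : Set A.Z) := fun x' hx' => by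
        have h1 := Finset.mem_filter.mp hx'
        exact ⟨(hmemS' x').mp h1.1, by rw [Set.mem_preimage, hDξ, h1.2]; exact Set.mem_singleton ξ⟩
      have hSon1 : Son = {x₀} :=
        Finset.eq_singleton_iff_unique_mem.mpr ⟨hx₀, fun x' hx' => huniq (hmem x' hx') (hmem x₀ hx₀)⟩
      rw [hSon1, Finset.sum_singleton]
      have h1 := Finset.mem_filter.mp hx₀
      have h2 := hon x₀ ((hmemS' x₀).mp h1.1) (by rw [hDξ, h1.2]; exact Set.mem_singleton ξ)
      rw [h1.2] at h2
      omega
  rw [hsplit, ← hSval]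
  omega

/-! ## 2. An admitted centre has weight `≥ 1` -/

open scoped Classical in
/-- **An admitted centre is not frozen** (`not_mohWindowSurface_transform_of_frozen_centre`), so its weight is `≥ 1`. [folklore] -/
theorem one_le_weight_of_mem_centre {D : Closeds A.Z} (π : A'.Z ⟶ A.Z) (hπ : IsBlowup π (vanishingIdeal D))
    (hD : E.IsPermissibleCentre A.hom D) (hRg : Regime.mohWindowSurface A E)
    (hRg' : Regime.mohWindowSurface A' (E.transform π D)) {x : A.Z} (hxD : x ∈ (D : Set A.Z)) :
    1 ≤ (if ∃ s q w η r η_S η_Q η_W : A.Z.presheaf.stalk x, Ideal.span {s, q, w} = maximalIdeal _ ∧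
        η - (η_S * s + η_Q * q + η_W * w) ∈ maximalIdeal _ ^ 2 ∧ IsUnit η_Q ∧ r ∈ maximalIdeal _ ^ 4 ∧
        stalkIdeal E.J x = Ideal.span {w ^ 2 + (s ^ 2 * η + r)} then 0
      else if ∃ s q w η G η_S η_Q η_W : A.Z.presheaf.stalk x, Ideal.span {s, q, w} = maximalIdeal _ ∧
        η - (η_S * s + η_Q * q + η_W * w) ∈ maximalIdeal _ ^ 2 ∧ IsUnit η_S ∧ η_Q ∈ maximalIdeal _ ∧ IsUnit G ∧
        stalkIdeal E.J x = Ideal.span {w ^ 2 + (s ^ 2 * η + s * q ^ 3 * G)} then 1 else 2) := by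
  classical
  have hxS : x ∈ E.sing := hD.subset_sing hxD
  have hnotF : ¬ ∃ s q w η r η_S η_Q η_W : A.Z.presheaf.stalk x, Ideal.span {s, q, w} = maximalIdeal _ ∧
      η - (η_S * s + η_Q * q + η_W * w) ∈ maximalIdeal _ ^ 2 ∧ IsUnit η_Q ∧ r ∈ maximalIdeal _ ^ 4 ∧
      stalkIdeal E.J x = Ideal.span {w ^ 2 + (s ^ 2 * η + r)} := by
    rintro ⟨s, q, w, η, r, η_S, η_Q, η_W, hsqw, hη, hQ, hr, hJ⟩
    exact not_mohWindowSurface_transform_of_frozen_centre π hπ hD hRg hxD hxS hsqw hη hQ hr hJ hRg'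
  rw [if_neg hnotF]
  split_ifs <;> norm_num

/-! ## 3. The global length bound -/

open scoped Classical in
/-- **[OURS · L1 W4.6 rung (iii-2), `p = 2`] EVERY PERMISSIBLE SEQUENCE INSIDE THE PURELY INSEPARABLE SURFACE WINDOW AT `p = 2`
HAS LENGTH AT MOST `2 · #Sing(E₀)`.** For a finite §2.1-permissible sequence all of whose stages lie in `Regime.mohWindowSurface`
(`p = 2`, any field `K` of characteristic `2`): `len ≤ 2 · #Sing(E₀)`. The potential `Σ_{Sing(E_k)} weight` (weights `0/1/2`:
frozen / pure / other) satisfies `Φ_{k+1} + 1 ≤ Φ_k` (`sum_val_succ_add_one_le` with `…TerminationTwo`'s transport/drop,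
`one_le_weight_of_mem_centre`, and fibre uniqueness `sing_inter_preimage_centre_subsingleton`), and `Φ₀ ≤ 2 · #Sing(E₀)`.
NOT a statement of the manuscript. [folklore] -/
theorem FinPermissibleRun.len_le_two_mul_ncard_sing (r : FinPermissibleRun 2 K)
    (hr : ∀ k, k ≤ r.len → Regime.mohWindowSurface (r.A k) (r.E k)) :
    r.len ≤ 2 * (r.E 0).sing.ncard := by
  classical
  let val : (k : ℕ) → (r.A k).Z → ℕ := fun k x =>
    if ∃ s q w η ρ η_S η_Q η_W : (r.A k).Z.presheaf.stalk x, Ideal.span {s, q, w} = maximalIdeal _ ∧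
        η - (η_S * s + η_Q * q + η_W * w) ∈ maximalIdeal _ ^ 2 ∧ IsUnit η_Q ∧ ρ ∈ maximalIdeal _ ^ 4 ∧
        stalkIdeal (r.E k).J x = Ideal.span {w ^ 2 + (s ^ 2 * η + ρ)} then 0
      else if ∃ s q w η G η_S η_Q η_W : (r.A k).Z.presheaf.stalk x, Ideal.span {s, q, w} = maximalIdeal _ ∧
        η - (η_S * s + η_Q * q + η_W * w) ∈ maximalIdeal _ ^ 2 ∧ IsUnit η_S ∧ η_Q ∈ maximalIdeal _ ∧ IsUnit G ∧
        stalkIdeal (r.E k).J x = Ideal.span {w ^ 2 + (s ^ 2 * η + s * q ^ 3 * G)} then 1 else 2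
  -- the potential step, stated for an arbitrary next stage `E₁ = transform` (dependent rewriting along `E_succ`)
  have key : ∀ k (hk : Regime.mohWindowSurface (r.A k) (r.E k)) (E₁ : IdealExponent (r.A (k + 1)).Z)
      (h₁ : Regime.mohWindowSurface (r.A (k + 1)) E₁) (heq : E₁ = (r.E k).transform (r.π k) (r.D k))
      (hperm : (r.E k).IsPermissibleCentre (r.A k).hom (r.D k)) (hbl : IsBlowup (r.π k) (vanishingIdeal (r.D k))),
      (∑ x ∈ h₁.2.1.toFinset, (if ∃ s q w η ρ η_S η_Q η_W : (r.A (k + 1)).Z.presheaf.stalk x,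
            Ideal.span {s, q, w} = maximalIdeal _ ∧ η - (η_S * s + η_Q * q + η_W * w) ∈ maximalIdeal _ ^ 2 ∧ IsUnit η_Q ∧
            ρ ∈ maximalIdeal _ ^ 4 ∧ stalkIdeal E₁.J x = Ideal.span {w ^ 2 + (s ^ 2 * η + ρ)} then 0
          else if ∃ s q w η G η_S η_Q η_W : (r.A (k + 1)).Z.presheaf.stalk x, Ideal.span {s, q, w} = maximalIdeal _ ∧
            η - (η_S * s + η_Q * q + η_W * w) ∈ maximalIdeal _ ^ 2 ∧ IsUnit η_S ∧ η_Q ∈ maximalIdeal _ ∧ IsUnit G ∧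
            stalkIdeal E₁.J x = Ideal.span {w ^ 2 + (s ^ 2 * η + s * q ^ 3 * G)} then 1 else 2)) + 1 ≤
        ∑ x ∈ hk.2.1.toFinset, val k x := by
    intro k hk E₁ h₁ heq hperm hbl
    subst heq
    exact sum_val_succ_add_one_le (r.π k) hbl hperm hk.2.1 hk.2.2.1 h₁.2.1 _ _
      (fun x' _ hover => weight_eq_of_not_over_centre (E := r.E k) (r.π k) hbl hover)
      (fun x' hx' hover => weight_lt_of_over_centre (r.π k) hbl hperm hk h₁ hx' hover)
      (fun ξ hξ => one_le_weight_of_mem_centre (r.π k) hbl hperm hk h₁ hξ)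
      (sing_inter_preimage_centre_subsingleton (r.π k) hbl hperm hk h₁)
  -- telescoping: `Φ_k + k ≤ Φ_0` for `k ≤ len`
  have htel : ∀ k (hk : k ≤ r.len), (∑ x ∈ (hr k hk).2.1.toFinset, val k x) + k ≤ ∑ x ∈ (hr 0 (Nat.zero_le _)).2.1.toFinset, val 0 x := by
    intro k
    induction k with
    | zero => intro hk; simp
    | succ k ih =>
      intro hk1
      have hk : k ≤ r.len := Nat.le_of_succ_le hk1
      have hklt : k < r.len := hk1
      have hstep : (∑ x ∈ (hr (k + 1) hk1).2.1.toFinset, val (k + 1) x) + 1 ≤ ∑ x ∈ (hr k hk).2.1.toFinset, val k x :=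
        key k (hr k hk) (r.E (k + 1)) (hr (k + 1) hk1) (r.E_succ k hklt) (r.permissible k hklt) (r.blowup k hklt)
      have := ih hk
      omega
  -- `Φ_0 ≤ 2 · #Sing(E₀)`
  have hΦ0 : ∑ x ∈ (hr 0 (Nat.zero_le _)).2.1.toFinset, val 0 x ≤ 2 * (r.E 0).sing.ncard := by
    rw [Set.ncard_eq_toFinset_card _ (hr 0 (Nat.zero_le _)).2.1, mul_comm]
    refine (Finset.sum_le_sum fun x _ => show val 0 x ≤ 2 from ?_).trans (by rw [Finset.sum_const, smul_eq_mul])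
    simp only [val]
    split_ifs <;> norm_num
  have := htel r.len le_rfl
  omega

/-! ## 4. The named rung: the exit-bound form at `p = 2` -/

/-- **[OURS · L1 W4.6 rung (iii-2), `p = 2`] THE EXIT-BOUND FORM HOLDS in the coefficient surface-window regime at `p = 2`**:
`FinLocalExitBound (Regime.mohWindowSurface)` with `β(A, E, x) = 2 · #Sing(E)` — along every finite permissible sequence inside the
regime at most `2 · #Sing(E₀)` centres lie over any point of stage `0` (indeed at most that many centres at all,
`FinPermissibleRun.len_le_two_mul_ncard_sing`). NOT a statement of the manuscript. [folklore] -/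
theorem finLocalExitBound_mohWindowSurface_two : FinLocalExitBound (Regime.mohWindowSurface (p := 2) (K := K)) := by
  refine ⟨fun _ E _ => 2 * E.sing.ncard, fun r hr x s hs => ?_⟩
  have hlen := FinPermissibleRun.len_le_two_mul_ncard_sing r hr
  have hcard : s.card ≤ r.len := by
    calc s.card ≤ (Finset.range r.len).card :=
          Finset.card_le_card fun m hm => Finset.mem_range.mpr (hs m hm).1
      _ = r.len := Finset.card_range _
  exact hcard.trans hlen

/-- **[OURS · L1 W4.6 rung (iii-2), `p = 2`] THE NAMED EXIT-BOUND RUNG OF res-L1-type-o1's STATEMENT FILE HOLDS AT `p = 2`**: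
`MohWindowSurfaceInsepFinLocalExitBound 2 K` (o1, `…W46MohWindowSurface.lean` §3: `FinLocalExitBound regimeMohWindowSurfaceInsep` —
surface window germ `z² + f`, `2 < ord f < 4`, isolated singular locus, `E.b = 2`, at every stage), for EVERY field `K` of
characteristic `2`, with `β(A, E, x) = 2 · #Sing(E)` (the two regimes coincide, res-D-pv-050's
`regimeMohWindowSurfaceInsep_iff_mohWindowSurface`). With `…TerminationTwo.lean` BOTH non-tame all-window forms of RUNG MAP (iii-2)
are closed at `p = 2`. NOT a statement of the manuscript. [folklore] -/
theorem mohWindowSurfaceInsepFinLocalExitBound_two (K : Type u) [Field K] [CharP K 2] :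
    MohWindowSurfaceInsepFinLocalExitBound 2 K := by
  obtain ⟨β, hβ⟩ := finLocalExitBound_mohWindowSurface_two (K := K)
  exact ⟨β, fun r hr x s hs => hβ r (fun k hk => (regimeMohWindowSurfaceInsep_iff_mohWindowSurface _ _).mp (hr k hk)) x s hs⟩

/-- **Every permissible sequence inside `regimeMohWindowSurfaceInsep` at `p = 2` has length `≤ 2 · #Sing(E₀)`** (o1's §2 regime;
corollary of `FinPermissibleRun.len_le_two_mul_ncard_sing`). NOT a statement of the manuscript. [folklore] -/
theorem FinPermissibleRun.len_le_two_mul_ncard_sing_insep (r : FinPermissibleRun 2 K)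
    (hr : ∀ k, k ≤ r.len → regimeMohWindowSurfaceInsep (p := 2) (K := K) (r.A k) (r.E k)) :
    r.len ≤ 2 * (r.E 0).sing.ncard :=
  FinPermissibleRun.len_le_two_mul_ncard_sing r fun k hk => (regimeMohWindowSurfaceInsep_iff_mohWindowSurface _ _).mp (hr k hk)

end Campaign

end CampaignW46

end Summit.ResolutionOfSingularities.ResolutionOfSingularities.Theorems

end
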